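import Mathlib
import HarnessLib
import Summits.Ventures.LatticeQCDFlow.Exactness.SphereGradientFlow
import Summits.Ventures.LatticeQCDFlow.Exactness.SphereLuscherSeriesExistence
import Summits.Ventures.LatticeQCDFlow.Exactness.SphereLatticeLuscherKernel
import Summits.Ventures.LatticeQCDFlow.Exactness.SphereNLOFlowGenerator

/-!
# The gradient flow on the lattice of site spheres is a descent: `(d/dt) G(Φ_t x) = −Σ_n ‖∂̃_nG(Φ_t x)‖²`; Engel–Schaefer's leading-order trivializing flow `ẋ_n = T_n(x)` exists for all times and lowers the CP(N−1)/O(N) action at the rate `2κ²/(d−1)·Σ_n ‖p_n‖²`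

HONEST FRAMING: exact (Metropolis-corrected) sampling algorithms for lattice gauge theory;
figures of merit are autocorrelation/cost numbers at stated couplings and volumes; no
continuum-physics claim.

Venture `LatticeQCDFlow` (cell pub-lqcd), topic `Exactness`; FANOUT row 7 (`s0-cpn-null`: the
S0-D1 rung — Lüscher's LO trivializing map for 2D CP⁹ inside HMC, Engel–Schaefer 2011).  NEW WORK
of the cell over the tree's `Exactness/SphereGradientFlow.lean` (this leg: the global flow
`sphereGradientFlow hG` of `ẋ_n = −∂̃_nG(x)` on `Ω̃ = {‖x_n‖ = 1 ∀n}`, `hasDerivAt_sphereGradientFlow`,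
`norm_sphereGradientFlow_eq_one`), `Exactness/SphereLuscherSeriesExistence.lean` (GEN-9:
`⟪∂̃_kF, h⟫ = D_kF·h − ⟪x_k, h⟫E_kF`, tangency), `Exactness/LatticeSiteDerivatives.lean`
(`siteDeriv`), `Exactness/SphereLOFlowAction.lean` (E–S: `loFlowAction = S/(2(d−1))`,
`loGenerator = −∂̃S̃⁽⁰⁾ = (κ/(d−1))·p_n`, `‖∂̃_kS‖² = 4κ²‖p_k‖²` via
`Exactness/SphereActionVariance.lean`) and `Exactness/SphereLatticeLuscherKernel.lean`
(`contDiff_loFlowAction`) and `Exactness/SphereNLOFlowGenerator.lean` (`siteGrad_const_mul`);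
nothing is cited as a fact.  Printed counterpart, NAMED ONLY:
Engel–Schaefer, Comput. Phys. Commun. 182 (2011) 2107, §3 eqs. (14)–(16) (the gradient ansatz
`ẋ_n = T_n = −∂̃_nS̃`, at leading order `T_n ∝ p_n`); M. Lüscher, Commun. Math. Phys. 293 (2010)
899, §3 (flows generated by gradients of flow actions).

## Content (`Λ` finite, `E` finite-dimensional, `G ∈ C²`; `Φ_t = sphereGradientFlow hG · t`)

* §1 `siteDeriv_eq_fderiv_single'` (`D_kF(x)·v = DF(x)(δ_k v)` for differentiable `F`),
  `fderiv_apply_eq_sum_siteDeriv` (`DF(x)·w = Σ_k D_kF(x)·w_k`), and on `‖x_k‖ = 1`: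
  **`norm_sq_siteGrad_eq_siteDeriv`** — `‖∂̃_kF(x)‖² = D_kF(x)·∂̃_kF(x)` (the natural gradient is
  the tangential projection of the site gradient, and is itself tangent).
* §2 **`hasDerivAt_comp_sphereGradientFlow`** — THE DESCENT IDENTITY: for `x ∈ Ω̃`,
  `(d/dt) G(Φ_t x) = −Σ_k ‖∂̃_kG(Φ_t x)‖²`; **`antitone_comp_sphereGradientFlow`** — `t ↦ G(Φ_t x)`
  is non-increasing.
* §3 THE ENGEL–SCHAEFER LEADING-ORDER FLOW (`G = S̃⁽⁰⁾ = loFlowAction κ S₀ U`, no self-coupling,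
  adjoint pairs, `d ≥ 2`): **`hasDerivAt_loFlow`** — the flow of E–S's generator,
  `ẋ_n = T_n(x) = loGenerator κ S₀ U n x = (κ/(d−1))·p_n(x)`, exists for all times on `Ω̃` (it is
  `sphereGradientFlow` of `S̃⁽⁰⁾`); **`hasDerivAt_esAction_comp_loFlow`** — along it the ACTION obeys
  `(d/dt) S(Φ_t x) = −(2(d−1))⁻¹·Σ_n ‖∂̃_nS(Φ_t x)‖² = −(2κ²/(d−1))·Σ_n ‖p_n(Φ_t x)‖²`, and
  **`antitone_esAction_comp_loFlow`** — `S(Φ_t x)` is non-increasing in the flow time: the exact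
  LO trivializing flow is the gradient descent of the action, scaled by `1/(2(d−1))`.

NOT CLAIMED: anything about the Euler/geodesic DISCRETISATION the rung uses (E–S eq. (17);
`eulerStep_loGenerator` in the tree is the one-step map, not compared to `Φ_ε` here); convergence
to minima, rates, or Łojasiewicz-type statements; the Jacobian of `Φ_t`; the rung's numbers.
-/

noncomputable section

namespace Summit.Ventures.LatticeQCDFlow.Exactness

open Function Set Metric MeasureTheory NormedSpace InnerProductSpace
open scoped RealInnerProductSpace Topology

variable {Λ : Type*} {E : Type*} [NormedAddCommGroup E] [InnerProductSpace ℝ E]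
  [FiniteDimensional ℝ E] [Fintype Λ] [DecidableEq Λ]

/-! ## §1 Site derivatives of a differentiable functional -/

section SiteDeriv

variable {F : (Λ → E) → ℝ}

omit [FiniteDimensional ℝ E] in
/-- `D_kF(x)·v = DF(x)(δ_k v)` for `F` differentiable at `x` (the tree's
`siteDeriv_eq_fderiv_single` assumes `F ∈ C^∞`). -/
theorem siteDeriv_eq_fderiv_single' {x : Λ → E} (hF : DifferentiableAt ℝ F x) (k : Λ) (v : E) :
    siteDeriv k v F x = fderiv ℝ F x (Pi.single k v) := by
  unfold siteDeriv
  have hF' : DifferentiableAt ℝ F (update x k (x k)) := by rwa [update_eq_self]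
  rw [fderiv_fun_comp (x k) hF' (hasFDerivAt_update x (x k)).differentiableAt, update_eq_self,
    fderiv_update, ContinuousLinearMap.comp_apply]
  congr 1
  ext j
  by_cases hj : j = k
  · subst hj; simp
  · simp [hj]

omit [FiniteDimensional ℝ E] in
/-- `DF(x)·w = Σ_k D_kF(x)·w_k` (expand `w = Σ_k δ_k w_k`). -/
theorem fderiv_apply_eq_sum_siteDeriv {x : Λ → E} (hF : DifferentiableAt ℝ F x) (w : Λ → E) :
    fderiv ℝ F x w = ∑ k, siteDeriv k (w k) F x := by
  conv_lhs => rw [← Finset.univ_sum_single w]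
  rw [map_sum]
  exact Finset.sum_congr rfl fun k _ => (siteDeriv_eq_fderiv_single' hF k (w k)).symm

omit [Fintype Λ] in
/-- **`‖∂̃_kF(x)‖² = D_kF(x)·∂̃_kF(x)` on `‖x_k‖ = 1`**: pair E–S eq. (12)
(`⟪∂̃_kF, h⟫ = D_kF·h − ⟪x_k, h⟫·E_kF`) with `h = ∂̃_kF`, which is tangent. -/
theorem norm_sq_siteGrad_eq_siteDeriv {x : Λ → E} {k : Λ} (hx : ‖x k‖ = 1)
    (hF : DifferentiableAt ℝ (fun y => F (update x k y)) (x k)) :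
    ‖siteGrad k F x‖ ^ 2 = siteDeriv k (siteGrad k F x) F x := by
  rw [← real_inner_self_eq_norm_sq, inner_siteGrad hx hF, inner_self_siteGrad hx hF, zero_mul,
    sub_zero]

end SiteDeriv

/-! ## §2 The descent identity -/

section Descent

variable {G : (Λ → E) → ℝ}

/-- **THE DESCENT IDENTITY**: for `G ∈ C²` and `x ∈ Ω̃`,
`(d/dt) G(Φ_t x) = −Σ_k ‖∂̃_kG(Φ_t x)‖²` along the gradient flow `ẋ_n = −∂̃_nG(x)`. -/
theorem hasDerivAt_comp_sphereGradientFlow (hG : ContDiff ℝ 2 G) {x : Λ → E}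
    (hx : ∀ n, ‖x n‖ = 1) (t : ℝ) :
    HasDerivAt (fun s => G (sphereGradientFlow hG x s))
      (-∑ k, ‖siteGrad k G (sphereGradientFlow hG x t)‖ ^ 2) t := by
  have hGd : Differentiable ℝ G := hG.differentiable (by norm_num)
  set y := sphereGradientFlow hG x t with hy
  have hy1 : ∀ n, ‖y n‖ = 1 := norm_sphereGradientFlow_eq_one hG hx t
  have hflow := hasDerivAt_sphereGradientFlow hG hx t
  have hchain : HasDerivAt (fun s => G (sphereGradientFlow hG x s))
      (fderiv ℝ G y (fun n => -siteGrad n G y)) t :=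
    (hGd y).hasFDerivAt.comp_hasDerivAt t hflow
  have hval : fderiv ℝ G y (fun n => -siteGrad n G y) = -∑ k, ‖siteGrad k G y‖ ^ 2 := by
    rw [fderiv_apply_eq_sum_siteDeriv (hGd y), ← Finset.sum_neg_distrib]
    refine Finset.sum_congr rfl fun k _ => ?_
    have hsec : DifferentiableAt ℝ (fun z => G (update y k z)) (y k) :=
      ((hGd.comp (contDiff_update 1 y k).differentiable_one) (y k))
    rw [norm_sq_siteGrad_eq_siteDeriv (hy1 k) hsec, siteDeriv, siteDeriv, map_neg]
  rwa [hval] at hchain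

/-- The composite `t ↦ G(Φ_t x)` is differentiable. -/
theorem differentiable_comp_sphereGradientFlow (hG : ContDiff ℝ 2 G) {x : Λ → E}
    (hx : ∀ n, ‖x n‖ = 1) : Differentiable ℝ fun s => G (sphereGradientFlow hG x s) :=
  fun t => (hasDerivAt_comp_sphereGradientFlow hG hx t).differentiableAt

/-- **`t ↦ G(Φ_t x)` IS NON-INCREASING** along the gradient flow on the lattice of site spheres. -/
theorem antitone_comp_sphereGradientFlow (hG : ContDiff ℝ 2 G) {x : Λ → E} (hx : ∀ n, ‖x n‖ = 1) :
    Antitone fun s => G (sphereGradientFlow hG x s) := by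
  refine antitone_of_deriv_nonpos (differentiable_comp_sphereGradientFlow hG hx) fun t => ?_
  rw [(hasDerivAt_comp_sphereGradientFlow hG hx t).deriv, neg_nonpos]
  exact Finset.sum_nonneg fun k _ => sq_nonneg _

end Descent

/-! ## §3 Engel–Schaefer's leading-order flow lowers the action -/

section EngelSchaefer

variable {U : Λ → Λ → (E →L[ℝ] E)}

/-- **E–S's LEADING-ORDER FLOW EXISTS FOR ALL TIMES**: the gradient flow of `S̃⁽⁰⁾ = S/(2(d−1))`
on `Ω̃` solves `ẋ_n = T_n(x) = loGenerator κ S₀ U n x` (`= (κ/(d−1))·p_n(x)`, eq. (16)). -/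
theorem hasDerivAt_loFlow (κ S₀ : ℝ) {x : Λ → E} (hx : ∀ n, ‖x n‖ = 1) (t : ℝ) :
    HasDerivAt (sphereGradientFlow (contDiff_loFlowAction U κ S₀) x)
      (fun n => loGenerator κ S₀ U n (sphereGradientFlow (contDiff_loFlowAction U κ S₀) x t)) t :=
  hasDerivAt_sphereGradientFlow (contDiff_loFlowAction U κ S₀) hx t

/-- Along E–S's flow, in terms of the momenta-free force `p_n = P_{x_n}J_n`:
`ẋ_n = (κ/(d−1))·p_n(x)` (`d ≥ 2`, no self-coupling, adjoint pairs). -/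
theorem hasDerivAt_loFlow_tangentKick (hU0 : ∀ n, U n n = 0)
    (hUadj : ∀ m n (v w : E), ⟪U m n v, w⟫ = ⟪v, U n m w⟫) (hd : 2 ≤ Module.finrank ℝ E)
    (κ S₀ : ℝ) {x : Λ → E} (hx : ∀ n, ‖x n‖ = 1) (t : ℝ) :
    HasDerivAt (sphereGradientFlow (contDiff_loFlowAction U κ S₀) x)
      (fun n => (κ / ((Module.finrank ℝ E : ℝ) - 1)) •
        tangentKick (localField U n (sphereGradientFlow (contDiff_loFlowAction U κ S₀) x t))
          (sphereGradientFlow (contDiff_loFlowAction U κ S₀) x t n)) t := by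
  have h := hasDerivAt_loFlow (U := U) κ S₀ hx t
  have hy1 := norm_sphereGradientFlow_eq_one (contDiff_loFlowAction U κ S₀) hx t
  have e : (fun n => loGenerator κ S₀ U n (sphereGradientFlow (contDiff_loFlowAction U κ S₀) x t)) =
      fun n => (κ / ((Module.finrank ℝ E : ℝ) - 1)) •
        tangentKick (localField U n (sphereGradientFlow (contDiff_loFlowAction U κ S₀) x t))
          (sphereGradientFlow (contDiff_loFlowAction U κ S₀) x t n) := by
    funext n
    exact loGenerator_eq hU0 hUadj hd κ S₀ (hy1 n)
  rwa [e] at h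

/-- **THE ACTION ALONG E–S's LEADING-ORDER FLOW**:
`(d/dt) S(Φ_t x) = −(2(d−1))⁻¹·Σ_n ‖∂̃_nS(Φ_t x)‖²` (`d ≥ 2`). -/
theorem hasDerivAt_esAction_comp_loFlow (hd : 2 ≤ Module.finrank ℝ E) (κ S₀ : ℝ) {x : Λ → E}
    (hx : ∀ n, ‖x n‖ = 1) (t : ℝ) :
    HasDerivAt (fun s => esAction κ S₀ U (sphereGradientFlow (contDiff_loFlowAction U κ S₀) x s))
      (-(2 * ((Module.finrank ℝ E : ℝ) - 1))⁻¹ *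
        ∑ n, ‖siteGrad n (esAction κ S₀ U)
          (sphereGradientFlow (contDiff_loFlowAction U κ S₀) x t)‖ ^ 2) t := by
  set c : ℝ := 2 * ((Module.finrank ℝ E : ℝ) - 1) with hc
  have hc0 : c ≠ 0 := by
    have : (2 : ℝ) ≤ Module.finrank ℝ E := by exact_mod_cast hd
    rw [hc]; intro h; nlinarith
  have hG := contDiff_loFlowAction U κ S₀ (m := 2)
  have hy1 := norm_sphereGradientFlow_eq_one hG hx t
  have h := hasDerivAt_comp_sphereGradientFlow hG hx t
  -- `S = c · S̃⁽⁰⁾`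
  have hS : ∀ z : Λ → E, esAction κ S₀ U z = c * loFlowAction κ S₀ U z := fun z => by
    unfold loFlowAction
    rw [← hc, ← mul_assoc, mul_inv_cancel₀ hc0, one_mul]
  have h' : HasDerivAt (fun s => esAction κ S₀ U (sphereGradientFlow hG x s))
      (c * -∑ k, ‖siteGrad k (loFlowAction κ S₀ U) (sphereGradientFlow hG x t)‖ ^ 2) t := by
    have := h.const_mul c
    simp_rw [← hS] at this
    exact this
  -- `∂̃S̃⁽⁰⁾ = c⁻¹ ∂̃S`
  have hlo : loFlowAction κ S₀ U = fun x' => c⁻¹ * esAction κ S₀ U x' := by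
    funext x'
    unfold loFlowAction
    rw [← hc]
  have hgrad : ∀ k, siteGrad k (loFlowAction κ S₀ U) (sphereGradientFlow hG x t) =
      c⁻¹ • siteGrad k (esAction κ S₀ U) (sphereGradientFlow hG x t) := fun k => by
    set y := sphereGradientFlow hG x t with hy
    have hne : y k ≠ 0 := by
      intro h0; have := hy1 k; rw [h0, norm_zero] at this; exact zero_ne_one this
    rw [hlo]
    exact siteGrad_const_mul hne ((contDiff_esAction U κ S₀).comp (contDiff_update 1 _ k)) c⁻¹
  convert h' using 1
  simp_rw [hgrad, norm_smul, mul_pow, Real.norm_eq_abs, sq_abs, ← Finset.mul_sum]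
  field_simp

/-- … equivalently, with `‖∂̃_nS‖² = 4κ²‖p_n‖²`:
`(d/dt) S(Φ_t x) = −(2κ²/(d−1))·Σ_n ‖p_n(Φ_t x)‖²`, `p_n = P_{x_n}J_n` (no self-coupling, adjoint
pairs, `d ≥ 2`). -/
theorem hasDerivAt_esAction_comp_loFlow_tangentKick (hU0 : ∀ n, U n n = 0)
    (hUadj : ∀ m n (v w : E), ⟪U m n v, w⟫ = ⟪v, U n m w⟫) (hd : 2 ≤ Module.finrank ℝ E)
    (κ S₀ : ℝ) {x : Λ → E} (hx : ∀ n, ‖x n‖ = 1) (t : ℝ) :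
    HasDerivAt (fun s => esAction κ S₀ U (sphereGradientFlow (contDiff_loFlowAction U κ S₀) x s))
      (-(2 * κ ^ 2 / ((Module.finrank ℝ E : ℝ) - 1)) *
        ∑ n, ‖tangentKick (localField U n (sphereGradientFlow (contDiff_loFlowAction U κ S₀) x t))
          (sphereGradientFlow (contDiff_loFlowAction U κ S₀) x t n)‖ ^ 2) t := by
  have hd1 : ((Module.finrank ℝ E : ℝ) - 1) ≠ 0 := by
    have : (2 : ℝ) ≤ Module.finrank ℝ E := by exact_mod_cast hd
    intro h; linarith
  have hy1 := norm_sphereGradientFlow_eq_one (contDiff_loFlowAction U κ S₀ (m := 2)) hx t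
  have h := hasDerivAt_esAction_comp_loFlow (U := U) hd κ S₀ hx t
  convert h using 1
  have hk : ∀ n, ‖siteGrad n (esAction κ S₀ U)
      (sphereGradientFlow (contDiff_loFlowAction U κ S₀) x t)‖ ^ 2 =
      4 * κ ^ 2 * ‖tangentKick (localField U n (sphereGradientFlow (contDiff_loFlowAction U κ S₀) x t))
        (sphereGradientFlow (contDiff_loFlowAction U κ S₀) x t n)‖ ^ 2 := fun n => by
    rw [siteGrad_esAction hU0 hUadj κ S₀ (hy1 n), norm_smul, mul_pow, norm_neg, Real.norm_eq_abs,
      sq_abs]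
    ring
  simp_rw [hk, ← Finset.mul_sum]
  field_simp
  ring

/-- **THE ACTION IS NON-INCREASING ALONG E–S's LEADING-ORDER TRIVIALIZING FLOW** (`d ≥ 2`). -/
theorem antitone_esAction_comp_loFlow (hd : 2 ≤ Module.finrank ℝ E) (κ S₀ : ℝ) {x : Λ → E}
    (hx : ∀ n, ‖x n‖ = 1) :
    Antitone fun s => esAction κ S₀ U (sphereGradientFlow (contDiff_loFlowAction U κ S₀) x s) := by
  have hd' : 0 < 2 * ((Module.finrank ℝ E : ℝ) - 1) := by
    have : (2 : ℝ) ≤ Module.finrank ℝ E := by exact_mod_cast hd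
    linarith
  refine antitone_of_deriv_nonpos
    (fun t => (hasDerivAt_esAction_comp_loFlow (U := U) hd κ S₀ hx t).differentiableAt) fun t => ?_
  rw [(hasDerivAt_esAction_comp_loFlow (U := U) hd κ S₀ hx t).deriv, neg_mul, neg_nonpos]
  exact mul_nonneg (inv_nonneg.2 hd'.le) (Finset.sum_nonneg fun k _ => sq_nonneg _)

end EngelSchaefer

end Summit.Ventures.LatticeQCDFlow.Exactness

end
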